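import Literature.InformationTheory.QuantumCodes.QuantumExpanderSmallSetFlip
import HarnessLib

/-!
# The small-set-flip decoder is LOCAL (Fawzi–Grospellier–Leverrier 2018, Lemmas 20–21 and Proposition 12)
# — PROOF

Topic `Literature/InformationTheory/QuantumCodes` (venture QEC, PARTITION item 04.FGL1 = the small-set-flip
THRESHOLD theorem; ingredient "locality"). Source: FGL18 = arXiv:1711.08351v2, §3.3 Prop. 12 (p0011–p0012)
and §5 (Notation 19, Lemma 20, Lemma 21, proof of Prop. 12; p0015 L1–135). Generic over a syndrome matrix
`Hs : Matrix C Q (ZMod 2)` and a generator matrix `Hg : Matrix R Q (ZMod 2)` (for quantum expander codes: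
`expanderHX H`, `expanderHZ H`); the small-set-flip decoder is the nondeterministic procedure of
`QuantumExpanderCodes.lean` (`IsSSFStep`, `SSFHalts`, `IsSSFRun`, `runOutput`, threshold `κ`).

* `hammingNorm_add_add_two_mul_inter`, `syndromeDecrease_eq` — `|σ| − |σ ⊕ σ_X(F)| = 2|σ_X(F) ∩ σ| − |σ_X(F)|`
  (eq. (synd decreasing));
* `syndromeDecrease_indicator_le` / `_eq` — **Lemma 21**: `Δ(σ ∩ C_K, F) ≤ Δ(σ, F)`, with equality when
  `σ_X(F) ⊆ C_K` (the restriction `σ ∩ C_K` is `Set.indicator C_K σ`);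
* `indicator_mulVec_flipVec_eq` — **Lemma 20**: if no check touches both `K` and `U ∖ K` then
  `σ_X(W) ∩ C_K = σ_X(W ∩ K)` for `W ⊆ U`, `C_K = Γ_X(K)`;
* `ssfRun_restrict` — **Proposition 12 (locality), run form**: for a complete valid run with flips
  `F₀, …, F_{f−1} ⊆ U` and a part `K` closed in `U` for check- and generator-adjacency (a union of connected
  components of `U` in the syndrome-adjacency graph `𝒢`), the sub-sequence of flips inside `K` is a complete
  valid run from `σ ∩ C_K` whose output is the restriction of the output to `K` ("a valid execution with input
  `σ_X(E ∩ K)`, output `Ê ∩ K` and support `K`"); every other flip is disjoint from `K` and invisible on `C_K`.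

No named fact is used; the closure hypotheses are stated explicitly (no graph object is needed here).
-/

namespace Literature.InformationTheory.QuantumCodes

namespace SmallSetFlip

open Finset Matrix

variable {Q C R : Type*} [Fintype Q] [Fintype C] [DecidableEq Q] [DecidableEq C]

/-- `|σ ⊕ τ| + 2|σ ∩ τ| = |σ| + |τ|` for `0/1`-vectors (FGL18 eq. (synd decreasing), rearranged).
[cite: FawziGrospellierLeverrier2018, Lemma 21 proof eq. (synd decreasing) (§5 = arXiv v2 p0015 L33-36)] -/
theorem hammingNorm_add_add_two_mul_inter (σ τ : C → ZMod 2) :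
    hammingNorm (σ + τ) + 2 * ((univ.filter fun c => σ c ≠ 0) ∩ (univ.filter fun c => τ c ≠ 0)).card
      = hammingNorm σ + hammingNorm τ := by
  classical
  -- pointwise identity on indicator values
  have h01 : ∀ z : ZMod 2, z = 0 ∨ z = 1 := by decide
  have hpt : ∀ c, (if (σ + τ) c ≠ 0 then 1 else 0) + 2 * (if σ c ≠ 0 ∧ τ c ≠ 0 then 1 else 0)
      = (if σ c ≠ 0 then 1 else 0) + (if τ c ≠ 0 then (1 : ℕ) else 0) := by
    intro c
    rw [Pi.add_apply]
    have h11 : (1 : ZMod 2) + 1 = 0 := by decide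
    rcases h01 (σ c) with h | h <;> rcases h01 (τ c) with h' | h' <;> simp [h, h', h11]
  simp only [hammingNorm]
  rw [Finset.card_filter, Finset.card_filter, Finset.card_filter, ← Finset.filter_and, Finset.card_filter,
    Finset.mul_sum, ← Finset.sum_add_distrib, ← Finset.sum_add_distrib]
  exact Finset.sum_congr rfl fun c _ => hpt c

/-- **The syndrome decrease in closed form** (FGL18 eq. (synd decreasing)):
`|σ| − |σ ⊕ σ_X(F)| = 2|σ_X(F) ∩ σ| − |σ_X(F)|`.
[cite: FawziGrospellierLeverrier2018, Lemma 21 proof eq. (synd decreasing) (arXiv v2 p0015 L33-36)] -/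
theorem syndromeDecrease_eq (Hs : Matrix C Q (ZMod 2)) (σ : C → ZMod 2) (F : Finset Q) :
    syndromeDecrease Hs σ F
      = 2 * (((univ.filter fun c => σ c ≠ 0) ∩ (univ.filter fun c => (Hs *ᵥ flipVec F) c ≠ 0)).card : ℤ)
        - hammingNorm (Hs *ᵥ flipVec F) := by
  have h := hammingNorm_add_add_two_mul_inter σ (Hs *ᵥ flipVec F)
  rw [syndromeDecrease]
  have h' := congrArg (Nat.cast : ℕ → ℤ) h
  push_cast at h'
  linarith

/-- **FGL18 Lemma 21 (i):** restricting the syndrome to a set of checks `C_K` can only lower the decrease of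
any flip: `Δ(σ ∩ C_K, F) ≤ Δ(σ, F)` (here for the un-normalised decrease; divide by `|F|` for `Δ`).
[cite: FawziGrospellierLeverrier2018, Lemma 21 eq. (optim1) (§5, arXiv v2 p0015 L28-44)] -/
theorem syndromeDecrease_indicator_le (Hs : Matrix C Q (ZMod 2)) (σ : C → ZMod 2) (CK : Finset C)
    (F : Finset Q) :
    syndromeDecrease Hs (Set.indicator (CK : Set C) σ) F ≤ syndromeDecrease Hs σ F := by
  classical
  rw [syndromeDecrease_eq, syndromeDecrease_eq]
  have hsub : (univ.filter fun c => Set.indicator (CK : Set C) σ c ≠ 0)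
        ∩ (univ.filter fun c => (Hs *ᵥ flipVec F) c ≠ 0)
      ⊆ (univ.filter fun c => σ c ≠ 0) ∩ (univ.filter fun c => (Hs *ᵥ flipVec F) c ≠ 0) := by
    intro c hc
    rw [Finset.mem_inter, Finset.mem_filter, Finset.mem_filter] at hc ⊢
    refine ⟨⟨hc.1.1, ?_⟩, hc.2⟩
    intro h0
    apply hc.1.2
    by_cases hmem : c ∈ (CK : Set C)
    · rw [Set.indicator_of_mem hmem]; exact h0
    · rw [Set.indicator_of_notMem hmem]
  have := Finset.card_le_card hsub
  have : ((((univ.filter fun c => Set.indicator (CK : Set C) σ c ≠ 0)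
        ∩ (univ.filter fun c => (Hs *ᵥ flipVec F) c ≠ 0)).card : ℕ) : ℤ)
      ≤ (((univ.filter fun c => σ c ≠ 0) ∩ (univ.filter fun c => (Hs *ᵥ flipVec F) c ≠ 0)).card : ℤ) := by
    exact_mod_cast this
  linarith

/-- **FGL18 Lemma 21 (ii):** if the flip's syndrome lies inside `C_K` then restriction does not change the
decrease: `Δ(σ ∩ C_K, F) = Δ(σ, F)`.
[cite: FawziGrospellierLeverrier2018, Lemma 21 eq. (optim2) (§5, arXiv v2 p0015 L45-48)] -/
theorem syndromeDecrease_indicator_eq (Hs : Matrix C Q (ZMod 2)) (σ : C → ZMod 2) (CK : Finset C)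
    (F : Finset Q) (hF : ∀ c, (Hs *ᵥ flipVec F) c ≠ 0 → c ∈ CK) :
    syndromeDecrease Hs (Set.indicator (CK : Set C) σ) F = syndromeDecrease Hs σ F := by
  classical
  rw [syndromeDecrease_eq, syndromeDecrease_eq]
  have heq : (univ.filter fun c => Set.indicator (CK : Set C) σ c ≠ 0)
        ∩ (univ.filter fun c => (Hs *ᵥ flipVec F) c ≠ 0)
      = (univ.filter fun c => σ c ≠ 0) ∩ (univ.filter fun c => (Hs *ᵥ flipVec F) c ≠ 0) := by
    ext c
    rw [Finset.mem_inter, Finset.mem_filter, Finset.mem_filter, Finset.mem_inter, Finset.mem_filter,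
      Finset.mem_filter]
    constructor
    · rintro ⟨⟨-, h1⟩, -, h2⟩
      refine ⟨⟨Finset.mem_univ _, ?_⟩, Finset.mem_univ _, h2⟩
      intro h0; apply h1
      by_cases hmem : c ∈ (CK : Set C)
      · rw [Set.indicator_of_mem hmem]; exact h0
      · rw [Set.indicator_of_notMem hmem]
    · rintro ⟨⟨-, h1⟩, -, h2⟩
      refine ⟨⟨Finset.mem_univ _, ?_⟩, Finset.mem_univ _, h2⟩
      have hmem : c ∈ (CK : Set C) := by exact_mod_cast hF c h2
      rw [Set.indicator_of_mem hmem]; exact h1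
  rw [heq]

omit [Fintype C] in
/-- The indicator restriction of a syndrome kills nothing the flip can see: if `σ_X(F) ∩ C_K = ∅` then the
restricted syndrome is unchanged by adding `σ_X(F)` (`(σ ⊕ σ_X(F)) ∩ C_K = σ ∩ C_K`).
[cite: FawziGrospellierLeverrier2018, proof of Prop 12 ("flipping F_i does not change the syndrome part included in C_K"; arXiv v2 p0012 L12-14)] -/
theorem indicator_add_eq_of_disjoint (σ τ : C → ZMod 2) (CK : Finset C) (hτ : ∀ c, τ c ≠ 0 → c ∉ CK) :
    Set.indicator (CK : Set C) (σ + τ) = Set.indicator (CK : Set C) σ := by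
  ext c
  by_cases hmem : c ∈ (CK : Set C)
  · rw [Set.indicator_of_mem hmem, Set.indicator_of_mem hmem, Pi.add_apply]
    have : τ c = 0 := by
      by_contra h
      exact hτ c h (by exact_mod_cast hmem)
    rw [this, add_zero]
  · rw [Set.indicator_of_notMem hmem, Set.indicator_of_notMem hmem]

omit [Fintype C] in
/-- If `σ_X(F) ⊆ C_K` then restriction commutes with adding the flip's syndrome:
`(σ ⊕ σ_X(F)) ∩ C_K = (σ ∩ C_K) ⊕ σ_X(F)`.
[cite: FawziGrospellierLeverrier2018, proof of Prop 12 eq. (synd equal) (§5, arXiv v2 p0015 L128-133)] -/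
theorem indicator_add_eq_of_subset (σ τ : C → ZMod 2) (CK : Finset C) (hτ : ∀ c, τ c ≠ 0 → c ∈ CK) :
    Set.indicator (CK : Set C) (σ + τ) = Set.indicator (CK : Set C) σ + τ := by
  ext c
  by_cases hmem : c ∈ (CK : Set C)
  · rw [Pi.add_apply, Set.indicator_of_mem hmem, Set.indicator_of_mem hmem, Pi.add_apply]
  · rw [Pi.add_apply, Set.indicator_of_notMem hmem, Set.indicator_of_notMem hmem, zero_add]
    have : τ c = 0 := by
      by_contra h
      exact hmem (by exact_mod_cast hτ c h)
    rw [this]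

/-! ### FGL18 Lemma 20 and Proposition 12: runs restrict to closed parts of the support -/

/-- A small set lies inside one generator. [cite: FawziGrospellierLeverrier2018, §2.3 (𝓕 = {F ⊆ x : x ∈ 𝒳})] -/
theorem exists_subset_genSupport_of_mem_smallSets {Hg : Matrix R Q (ZMod 2)} [Fintype R] {F : Finset Q}
    (hF : F ∈ smallSets Hg) : ∃ g, F ⊆ genSupport Hg g := by
  classical
  rw [smallSets, Finset.mem_erase, Finset.mem_biUnion] at hF
  obtain ⟨g, -, hg⟩ := hF.2
  exact ⟨g, Finset.mem_powerset.1 hg⟩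

/-- **FGL18 Lemma 20 (syndrome locality).** Let `K ⊆ U` be closed in `U` for the check-adjacency
("`Γ_X(U ∖ K) ∩ Γ_X(K) = ∅`": no check touches both `K` and `U ∖ K`) and `C_K = Γ_X(K)` the checks touching
`K`. Then for every `W ⊆ U`: `σ_X(W) ∩ C_K = σ_X(W ∩ K)`.
[cite: FawziGrospellierLeverrier2018, Lemma 20 (§5, arXiv v2 p0015 L14-26)] -/
theorem indicator_mulVec_flipVec_eq (Hs : Matrix C Q (ZMod 2)) (U K W : Finset Q)
    (hKX : ∀ q ∈ K, ∀ q' ∈ U, ∀ c, Hs c q ≠ 0 → Hs c q' ≠ 0 → q' ∈ K) (hW : W ⊆ U) :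
    Set.indicator ((univ.filter fun c => ∃ q ∈ K, Hs c q ≠ 0 : Finset C) : Set C) (Hs *ᵥ flipVec W)
      = Hs *ᵥ flipVec (W ∩ K) := by
  classical
  ext c
  have hsum : ∀ (S : Finset Q), (Hs *ᵥ flipVec S) c = ∑ q ∈ S, Hs c q := by
    intro S
    simp only [Matrix.mulVec, dotProduct, flipVec, mul_ite, mul_one, mul_zero]
    rw [Finset.sum_ite_mem, Finset.univ_inter]
  by_cases hc : c ∈ ((univ.filter fun c => ∃ q ∈ K, Hs c q ≠ 0 : Finset C) : Set C)
  · rw [Set.indicator_of_mem hc, hsum, hsum]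
    have hc' : ∃ q ∈ K, Hs c q ≠ 0 := by
      have := hc; rw [Finset.mem_coe, Finset.mem_filter] at this; exact this.2
    obtain ⟨q, hqK, hq⟩ := hc'
    -- the terms of `W ∖ K` vanish
    rw [← Finset.sum_sdiff (Finset.inter_subset_left : W ∩ K ⊆ W)]
    have h0 : ∑ q' ∈ W \ (W ∩ K), Hs c q' = 0 := by
      refine Finset.sum_eq_zero fun q' hq' => ?_
      rw [Finset.mem_sdiff, Finset.mem_inter] at hq'
      by_contra hne
      exact hq'.2 ⟨hq'.1, hKX q hqK q' (hW hq'.1) c hq hne⟩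
    rw [h0, zero_add]
  · rw [Set.indicator_of_notMem hc, hsum]
    have hc' : ¬ ∃ q ∈ K, Hs c q ≠ 0 := by
      intro h; apply hc; rw [Finset.mem_coe, Finset.mem_filter]; exact ⟨Finset.mem_univ _, h⟩
    symm
    refine Finset.sum_eq_zero fun q hq => ?_
    by_contra hne
    exact hc' ⟨q, (Finset.mem_inter.1 hq).2, hne⟩

omit [DecidableEq C] in
/-- The syndrome of a flip inside `K` is supported on `C_K`. [cite: FawziGrospellierLeverrier2018, Lemma 21 (ii) hypothesis "F ⊆ K ⇒ σ_X(F) ⊆ C_K" (arXiv v2 p0015 L45-46)] -/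
theorem mulVec_flipVec_support_subset (Hs : Matrix C Q (ZMod 2)) {K F : Finset Q} (hF : F ⊆ K) (c : C)
    (hc : (Hs *ᵥ flipVec F) c ≠ 0) : c ∈ (univ.filter fun c => ∃ q ∈ K, Hs c q ≠ 0 : Finset C) := by
  classical
  rw [Finset.mem_filter]
  refine ⟨Finset.mem_univ _, ?_⟩
  by_contra hnone
  push Not at hnone
  apply hc
  simp only [Matrix.mulVec, dotProduct, flipVec, mul_ite, mul_one, mul_zero]
  rw [Finset.sum_ite_mem, Finset.univ_inter]
  exact Finset.sum_eq_zero fun q hq => hnone q (hF hq)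

omit [DecidableEq C] in
/-- The syndrome of a flip inside `U ∖ K` misses `C_K` (closure of `K`). [cite: FawziGrospellierLeverrier2018, proof of Prop 12 ("such i always satisfy F_i ∩ K = ∅ and thus flipping F_i does not change the syndrome part included in C_K"; arXiv v2 p0012 L12-14)] -/
theorem mulVec_flipVec_support_disjoint (Hs : Matrix C Q (ZMod 2)) (U K F : Finset Q)
    (hKX : ∀ q ∈ K, ∀ q' ∈ U, ∀ c, Hs c q ≠ 0 → Hs c q' ≠ 0 → q' ∈ K) (hFU : F ⊆ U)
    (hFK : Disjoint F K) (c : C) (hc : (Hs *ᵥ flipVec F) c ≠ 0) :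
    c ∉ (univ.filter fun c => ∃ q ∈ K, Hs c q ≠ 0 : Finset C) := by
  classical
  intro hmem
  rw [Finset.mem_filter] at hmem
  obtain ⟨q, hqK, hq⟩ := hmem.2
  apply hc
  simp only [Matrix.mulVec, dotProduct, flipVec, mul_ite, mul_one, mul_zero]
  rw [Finset.sum_ite_mem, Finset.univ_inter]
  refine Finset.sum_eq_zero fun q' hq' => ?_
  by_contra hne
  have := hKX q hqK q' (hFU hq') c hq hne
  exact Finset.disjoint_left.1 hFK hq' this

/-- **FGL18 Proposition 12 (locality of the small-set-flip decoder), PROVED in run form.** Let a complete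
valid run (threshold `κ`) flip `F₀, …, F_{f−1} ⊆ U`, and let `K` be closed in `U` both for the
check-adjacency and for the generator-adjacency (a union of connected components of `U` in the
syndrome-adjacency graph `𝒢`). Then the sub-sequence of flips lying inside `K` is a complete valid run
from the restricted syndrome `σ ∩ C_K`, and its output is the restriction of the output to `K`
("there is a valid execution of Algorithm 2 with input `σ_X(E ∩ K)`, output `Ê ∩ K` and support `K`";
combine with `indicator_mulVec_flipVec_eq` for the input `σ_X(E) ∩ C_K = σ_X(E ∩ K)`).
[cite: FawziGrospellierLeverrier2018, Prop 12 (§3.3, arXiv v2 p0011) and its proof (§5, p0015 L55-135), Lemmas 20-21] -/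
theorem ssfRun_restrict [Fintype R] {κ : ℝ} {Hs : Matrix C Q (ZMod 2)} {Hg : Matrix R Q (ZMod 2)}
    (U K : Finset Q)
    (hKX : ∀ q ∈ K, ∀ q' ∈ U, ∀ c, Hs c q ≠ 0 → Hs c q' ≠ 0 → q' ∈ K)
    (hKZ : ∀ q ∈ K, ∀ q' ∈ U, ∀ g, Hg g q ≠ 0 → Hg g q' ≠ 0 → q' ∈ K)
    {σ : C → ZMod 2} {l : List (Finset Q)} (hrun : IsSSFRun κ Hs Hg σ l) (hl : ∀ F ∈ l, F ⊆ U) :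
    IsSSFRun κ Hs Hg (Set.indicator ((univ.filter fun c => ∃ q ∈ K, Hs c q ≠ 0 : Finset C) : Set C) σ)
        (l.filter fun F => decide (F ⊆ K))
      ∧ runOutput (l.filter fun F => decide (F ⊆ K)) = Set.indicator (K : Set Q) (runOutput l) := by
  classical
  set CK : Finset C := univ.filter fun c => ∃ q ∈ K, Hs c q ≠ 0 with hCK
  induction hrun with
  | @halt σ hh =>
    refine ⟨?_, ?_⟩
    · simp only [List.filter_nil]
      refine IsSSFRun.halt ?_
      intro F hF ⟨hpos, hκ⟩
      have hle := syndromeDecrease_indicator_le Hs σ CK F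
      refine hh F hF ⟨lt_of_lt_of_le hpos hle, hκ.trans ?_⟩
      exact_mod_cast hle
    · simp [runOutput]
  | @step σ F l hF hrest ih =>
    have hFU : F ⊆ U := hl F (by simp)
    have hlU : ∀ F' ∈ l, F' ⊆ U := fun F' h => hl F' (by simp [h])
    obtain ⟨ih1, ih2⟩ := ih hlU
    obtain ⟨hFmem, hpos, hκ, hmax⟩ := hF
    by_cases hFK : F ⊆ K
    · -- the flip is kept
      have hsupp : ∀ c, (Hs *ᵥ flipVec F) c ≠ 0 → c ∈ CK := fun c hc =>
        mulVec_flipVec_support_subset Hs hFK c hc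
      have hdec : syndromeDecrease Hs (Set.indicator (CK : Set C) σ) F = syndromeDecrease Hs σ F :=
        syndromeDecrease_indicator_eq Hs σ CK F hsupp
      have hnext : Set.indicator (CK : Set C) (σ + Hs *ᵥ flipVec F)
          = Set.indicator (CK : Set C) σ + Hs *ᵥ flipVec F :=
        indicator_add_eq_of_subset σ _ CK hsupp
      refine ⟨?_, ?_⟩
      · rw [List.filter_cons_of_pos (by simpa using hFK)]
        refine IsSSFRun.step ⟨hFmem, by rw [hdec]; exact hpos, by rw [hdec]; exact hκ, ?_⟩ ?_
        · intro F' hF'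
          have h1 : (syndromeDecrease Hs (Set.indicator (CK : Set C) σ) F' : ℝ) / F'.card
              ≤ (syndromeDecrease Hs σ F' : ℝ) / F'.card := by
            have := syndromeDecrease_indicator_le Hs σ CK F'
            exact div_le_div_of_nonneg_right (by exact_mod_cast this) (Nat.cast_nonneg _)
          rw [hdec]
          exact h1.trans (hmax F' hF')
        · rw [← hnext]; exact ih1
      · rw [List.filter_cons_of_pos (by simpa using hFK), QuantumExpander.runOutput_cons, QuantumExpander.runOutput_cons, ih2]
        ext q
        by_cases hq : q ∈ (K : Set Q)
        · rw [Pi.add_apply, Set.indicator_of_mem hq, Set.indicator_of_mem hq, Pi.add_apply]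
        · rw [Pi.add_apply, Set.indicator_of_notMem hq, Set.indicator_of_notMem hq, add_zero]
          have : q ∉ F := fun h => hq (by exact_mod_cast hFK h)
          simp [flipVec, this]
    · -- the flip is skipped: it is disjoint from `K`
      have hdisj : Disjoint F K := by
        rw [Finset.disjoint_left]
        intro q hqF hqK
        apply hFK
        intro q' hq'
        obtain ⟨g, hg⟩ := exists_subset_genSupport_of_mem_smallSets hFmem
        have h1 : Hg g q ≠ 0 := by have := hg hqF; rw [genSupport, Finset.mem_filter] at this; exact this.2
        have h2 : Hg g q' ≠ 0 := by have := hg hq'; rw [genSupport, Finset.mem_filter] at this; exact this.2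
        exact hKZ q hqK q' (hFU hq') g h1 h2
      have hsupp : ∀ c, (Hs *ᵥ flipVec F) c ≠ 0 → c ∉ CK := fun c hc =>
        mulVec_flipVec_support_disjoint Hs U K F hKX hFU hdisj c hc
      have hnext : Set.indicator (CK : Set C) (σ + Hs *ᵥ flipVec F) = Set.indicator (CK : Set C) σ :=
        indicator_add_eq_of_disjoint σ _ CK hsupp
      refine ⟨?_, ?_⟩
      · rw [List.filter_cons_of_neg (by simpa using hFK), ← hnext]
        exact ih1
      · rw [List.filter_cons_of_neg (by simpa using hFK), QuantumExpander.runOutput_cons, ih2]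
        ext q
        by_cases hq : q ∈ (K : Set Q)
        · rw [Set.indicator_of_mem hq, Set.indicator_of_mem hq, Pi.add_apply]
          have : q ∉ F := fun h => Finset.disjoint_left.1 hdisj h (by exact_mod_cast hq)
          simp [flipVec, this]
        · rw [Set.indicator_of_notMem hq, Set.indicator_of_notMem hq]

end SmallSetFlip

end Literature.InformationTheory.QuantumCodes
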